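import Literature.AlgebraicGeometry.ShimuraVarieties.UnitaryShimuraCurveEmbeddedImageStable
import Literature.AlgebraicGeometry.ShimuraVarieties.UnitaryShimuraCurveEmbeddingWitnessReduction
import Literature.AlgebraicGeometry.ShimuraVarieties.UnitaryShimuraCurveHeckePoints
import Literature.NumberTheory.Automorphic.UnitaryNegConeCocompactRankTwo
import HarnessLib

/-!
# The complex Shimura set of the unitary Shimura CURVE is compact Hausdorff

Topic `AlgebraicGeometry/ShimuraVarieties`, namespace `…ShimuraVarieties.UnitaryCanonicalModel`.  THEOREMS ONLY (no definition, no
named fact, no instance, no `sorry`).  Cell `hodgecm-mathlib`, road (ii) of the GS-3 census, leaf L3.1 (F-CPT) of A-p10's cut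
`A-provers/A-p10/CUT-R2-5-FIELDS.A-p10g7.md` §2: the topological inputs of the field `pts` of the descended curve record (L3.4
`exists_homeomorph_complexPoints_of_range_eq_closure_embPoints`: a continuous bijection from a COMPACT space onto a HAUSDORFF one).

* §1 `ShimuraSetGS.t2Space_of_injective_embPoints` — if the sub-ball inclusion ★ `ShimuraSetGS.embPoints :
  Sh_{K⋆}(U(J⋆))(ℂ) → Sh_K(U(H))(ℂ)` into the complex points of a canonical model of the compact unitary Shimura SURFACE is injective
  (A-p15's (F-INJ) at small trace levels, [Deligne1971TravauxShimura] Prop. 1.15), then `Sh_{K⋆}(U(J⋆))(ℂ)` is Hausdorff: `embPoints` is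
  continuous (★ `ShimuraSetGS.continuous_embPoints`) and `Sh_K(U(H))(ℂ) ≃ₜ (M_K)_τ(ℂ)` (★ `RecordSystem.exists_homeomorph_complexFibre`)
  is Hausdorff because `M_K` is projective (★ `ComplexPoints.t2Space_of_isSeparated`).
* §2 `ShimuraSetGS.compactSpace_of_anisotropic` — for an ANISOTROPIC `J⋆` of signature `(1,1)` at `τ` and an OPEN level `K⋆`,
  `Sh_{K⋆}(U(J⋆))(ℂ) = U(J⋆)(L⁺) \ [𝔻 × U(J⋆)(𝔸_{L⁺,f}) / K⋆]` is COMPACT: finitely many double cosets (★ `finite_shimuraIndex` at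
  `N = 2`, [PlatonovRapinchuk1994] Thm. 5.1) and, on each piece, a compact fundamental set of the arithmetic group `Γ(g K⋆ g⁻¹)` on the
  disc (★ `exists_isCompact_negCone_fundamental_conj`, [Godement1964] / [BorelHarishchandra1962]) — so the set is a finite union of
  continuous images of compact sets (★ `ShimuraSetGS.continuous_mk_left`, ★ `ShimuraSetGS.mk_smul_mulVec`, ★ `ShimuraSetGS.mk_mul_of_mem`).
  §3 `…_of_frame`: the same with the anisotropy of `J⋆` derived from that of `H` through a frame (★ `anisotropic_of_frame`).

## References
* [Deligne1971TravauxShimura] P. Deligne, *Travaux de Shimura* (1971), Prop. 1.15 p. 132; 2.1.2.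
* [Milne2005ShimuraVarieties] J. S. Milne, *Introduction to Shimura varieties* (2005/2017), Lemma 5.13 p. 57, Thm. 5.16.
* [PlatonovRapinchuk1994] V. Platonov, A. Rapinchuk, *Algebraic Groups and Number Theory* (1994), §5.1 Thm. 5.1 (finiteness of the class
  number), §4.6 (compactness criterion).
* [Godement1964] R. Godement, *Domaines fondamentaux des groupes arithmétiques*, Sém. Bourbaki 257 (1964), Thm. 4.2.
* [BorelHarishchandra1962] A. Borel, Harish-Chandra, *Arithmetic subgroups of algebraic groups*, Ann. Math. 75 (1962), Thm. 11.8.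
-/

noncomputable section

open Function MulAction Topology NumberField IsDedekindDomain CategoryTheory Matrix AlgebraicGeometry
open scoped Matrix Pointwise
open Literature.AlgebraicGeometry.Motives Literature.NumberTheory.Automorphic Literature.NumberTheory.Automorphic.UnitaryGroup
open Literature.NumberTheory.Automorphic.ShimuraDissection
open Literature.NumberTheory.Automorphic.Liu2021.AppendixC (C5.OpenCompactSubgroup C5.SmallLevel)
open Literature.Geometry.ComplexHyperbolic Literature.Geometry.ComplexHyperbolic.BallModel

namespace Literature.AlgebraicGeometry.ShimuraVarieties.UnitaryCanonicalModel

variable {L : Type} [Field L] [NumberField L] [IsCMField L]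

/-! ### §1 Hausdorff: a continuous injection into the (Hausdorff) complex points of the surface model -/

section Hausdorff

variable {Jstar : Matrix (Fin 2) (Fin 2) L} {τ : L →+* ℂ}
  {H : Matrix (Fin 3) (Fin 3) L} {T : GL (Fin 3) ℂ} {hT : formCongr (starRingEnd ℂ) T (H.map τ) = BallModel.J}
  {K₀' : C5.OpenCompactSubgroup ↥(finAdelic (↥(maximalRealSubfield L)) L (IsCMField.complexConj L) 3 H)}
  (R : RecordSystem L H τ T hT K₀')
  (Jperp : Matrix (Fin 1) (Fin 1) L) (B : GL (Fin 3) L) {a : L} (ha : a ≠ 0)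
  (hB : formCongr ((IsCMField.complexConj L : L ≃ₐ[↥(maximalRealSubfield L)] L) : L →+* L) B (a • H) = finSum 2 1 Jstar Jperp)
  (hτa : 0 < (τ a).re) (hτa' : (τ a).im = 0)
  (Kstar : Subgroup ↥(finAdelic (↥(maximalRealSubfield L)) L (IsCMField.complexConj L) 2 Jstar))
  (K : C5.SmallLevel K₀') (hK : Kstar.map (φGS L Jstar Jperp H B ha hB) ≤ K.1.1)

set_option maxHeartbeats 400000 in -- instance-heavy adelic / Shimura-set statement (as ★ `UnitaryShimuraCurveEmbeddedImageStable` §2)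
include R in
/-- **`Sh_{K⋆}(U(J⋆))(ℂ)` is Hausdorff at injective levels** ([Deligne1971TravauxShimura] Prop. 1.15: at small `K`, `Sh_{K⋆} ↪ Sh_K`): if
★ `ShimuraSetGS.embPoints` into the complex points of a canonical model `M_K` of the compact unitary Shimura surface is injective, then
the curve's Shimura set at level `K⋆` is a `T2Space` — a continuous (★ `ShimuraSetGS.continuous_embPoints`) injection into
`Sh_K(U(H))(ℂ) ≃ₜ (M_K)_τ(ℂ)` (★ `RecordSystem.exists_homeomorph_complexFibre`), which is Hausdorff since `M_K` is projective
(★ `ComplexPoints.t2Space_of_isSeparated`). [cite: Deligne1971TravauxShimura, Prop. 1.15 p. 132] [cite: Milne2005ShimuraVarieties, Lemma 5.13 p. 57] -/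
theorem ShimuraSetGS.t2Space_of_injective_embPoints
    (hinj : Function.Injective (ShimuraSetGS.embPoints L H τ T hT Jstar Jperp B ha hB hτa hτa' Kstar K.1.1 hK)) :
    T2Space (ShimuraSetGS L Jstar τ Kstar) := by
  letI : Algebra L ℂ := τ.toAlgebra
  haveI : IsProper ((Motives.baseChangeHom τ).obj (R.M.obj K)).hom := (R.projective_complexFibre K).isProper
  haveI : T2Space (ComplexPoints ((Motives.baseChangeHom τ).obj (R.M.obj K))) := ComplexPoints.t2Space_of_isSeparated _
  obtain ⟨e, -⟩ := R.exists_homeomorph_complexFibre K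
  haveI : T2Space (ShimuraSet L H τ T hT K.1.1) := e.t2Space
  exact T2Space.of_injective_continuous hinj
    (ShimuraSetGS.continuous_embPoints L H τ T hT Jstar Jperp B ha hB hτa hτa' Kstar K.1.1 hK)

end Hausdorff

/-! ### §2 Compact: finitely many double cosets, each piece the image of a compact fundamental set -/

section Compact

variable (L) (Jstar : Matrix (Fin 2) (Fin 2) L) (τ : L →+* ℂ)

/-- Plumbing: `[v, (a·k)K⋆] = [v, aK⋆]` read with the factor on the LEFT of a conjugate — for `g⁻¹ (x g) ∈ K⋆`, `[v, x·g K⋆] = [v, g K⋆]`.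
[cite: Milne2005ShimuraVarieties, §5 (5.1) p. 56] -/
private theorem ShimuraSetGS.mk_mul_eq_mk_of_conj_mem
    (Kstar : Subgroup ↥(finAdelic (↥(maximalRealSubfield L)) L (IsCMField.complexConj L) 2 Jstar))
    (v : Fin 2 → ℂ) (hv : v ∈ negCone (Jstar.map τ))
    (g x : ↥(finAdelic (↥(maximalRealSubfield L)) L (IsCMField.complexConj L) 2 Jstar)) (hx : g⁻¹ * (x * g) ∈ Kstar) :
    ShimuraSetGS.mk L Jstar τ Kstar v hv (x * g) = ShimuraSetGS.mk L Jstar τ Kstar v hv g := by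
  have h : x * g = g * (g⁻¹ * (x * g)) := by group
  rw [h]
  exact ShimuraSetGS.mk_mul_of_mem L Jstar τ Kstar v hv g hx

set_option maxHeartbeats 400000 in -- `Finite (orbitRel.Quotient …)` and the Shimura-set statement are instance-heavy
/-- **`Sh_{K⋆}(U(J⋆), 𝔻)(ℂ)` is COMPACT** for an anisotropic `J⋆ ∈ M₂(L)` with a signature-`(1,1)` frame at `τ` and an open level `K⋆`:
the double coset space `U(J⋆)(L⁺) \ U(J⋆)(𝔸_{L⁺,f}) / K⋆` is finite (★ `finite_shimuraIndex` at `N = 2`), and for each representative `g`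
the arithmetic group `Γ(g K⋆ g⁻¹)` has a compact fundamental set `F_g` on the disc of negative lines (★ `exists_isCompact_negCone_fundamental_conj`),
whence `Sh_{K⋆}(ℂ) = ⋃_g {[v, g K⋆] : v ∈ F_g}` is a finite union of continuous images (★ `ShimuraSetGS.continuous_mk_left`) of compact sets.
The compactness of the CURVE `Sh_{K⋆}` ([Milne2005ShimuraVarieties] Thm. 5.16 / [Deligne1971TravauxShimura] 2.1.2: compact when `G` is anisotropic).
[cite: PlatonovRapinchuk1994, §5.1 Thm. 5.1 and §4.6] [cite: Godement1964, Thm. 4.2] [cite: Milne2005ShimuraVarieties, Lemma 5.13 p. 57 and Thm. 5.16] -/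
theorem ShimuraSetGS.compactSpace_of_anisotropic
    (hanis : ∀ x : Fin 2 → L, hermForm (cmConjRingHom L) Jstar x x = 0 → x = 0)
    {Tstar : GL (Fin 2) ℂ} (hTstar : formCongr (starRingEnd ℂ) Tstar (Jstar.map τ) = Matrix.diagonal ![(1 : ℂ), -1])
    (Kstar : Subgroup ↥(finAdelic (↥(maximalRealSubfield L)) L (IsCMField.complexConj L) 2 Jstar))
    (hKo : IsOpen (Kstar : Set ↥(finAdelic (↥(maximalRealSubfield L)) L (IsCMField.complexConj L) 2 Jstar))) :
    CompactSpace (ShimuraSetGS L Jstar τ Kstar) := by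
  classical
  -- finitely many double cosets, with representatives `g q`
  haveI := finite_shimuraIndex L 2 Jstar hanis Kstar hKo
  set Q := orbitRel.Quotient ↥(rational (↥(maximalRealSubfield L)) L (IsCMField.complexConj L) 2 Jstar)
      (CosetSpace (rationalToFinAdelic (↥(maximalRealSubfield L)) L (IsCMField.complexConj L) 2 Jstar) Kstar) with hQ
  have hrep : ∀ q : Q, ∃ g : ↥(finAdelic (↥(maximalRealSubfield L)) L (IsCMField.complexConj L) 2 Jstar),
      (Quotient.mk'' (CosetSpace.pt (rationalToFinAdelic (↥(maximalRealSubfield L)) L (IsCMField.complexConj L) 2 Jstar)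
        Kstar g) : Q) = q := by
    intro q
    induction q using Quotient.inductionOn' with | h x => ?_
    obtain ⟨g, rfl⟩ := CosetSpace.pt_surjective
      (rationalToFinAdelic (↥(maximalRealSubfield L)) L (IsCMField.complexConj L) 2 Jstar) Kstar x
    exact ⟨g, rfl⟩
  choose g hg using hrep
  -- a compact fundamental set `F q` of `Γ(g_q K⋆ g_q⁻¹)` on the disc, for each representative
  have hF : ∀ q : Q, ∃ F ⊆ negCone (Jstar.map τ), IsCompact F ∧ ∀ v ∈ negCone (Jstar.map τ),
      ∃ δ : ↥(rational (↥(maximalRealSubfield L)) L (IsCMField.complexConj L) 2 Jstar),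
        (g q)⁻¹ * ((rationalToFinAdelic (↥(maximalRealSubfield L)) L (IsCMField.complexConj L) 2 Jstar δ :
          ↥(finAdelic (↥(maximalRealSubfield L)) L (IsCMField.complexConj L) 2 Jstar)) * g q) ∈ Kstar ∧
        ∃ c : ℂ, c ≠ 0 ∧
          c • ((((Matrix.GeneralLinearGroup.map τ (δ : GL (Fin 2) L)) : GL (Fin 2) ℂ) : Matrix (Fin 2) (Fin 2) ℂ) *ᵥ v) ∈ F :=
    fun q => exists_isCompact_negCone_fundamental_conj L Jstar τ hanis hTstar Kstar hKo (g q)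
  choose F hFsub hFc hFfund using hF
  -- the piece maps on the cone and the compact pieces
  let pc : Q → ↥(negCone (Jstar.map τ)) → ShimuraSetGS L Jstar τ Kstar :=
    fun q x => ShimuraSetGS.mk L Jstar τ Kstar (x : Fin 2 → ℂ) x.2 (g q)
  have hpc : ∀ q, Continuous (pc q) := fun q => ShimuraSetGS.continuous_mk_left L Jstar τ Kstar (g q)
  have hFc' : ∀ q, IsCompact ((Subtype.val : ↥(negCone (Jstar.map τ)) → Fin 2 → ℂ) ⁻¹' F q) := by
    intro q
    refine Subtype.isCompact_iff.2 ?_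
    rw [Set.image_preimage_eq_inter_range, Subtype.range_coe, Set.inter_eq_left.2 (hFsub q)]
    exact hFc q
  -- every class lies in some piece image
  refine ⟨?_⟩
  have hcover : (Set.univ : Set (ShimuraSetGS L Jstar τ Kstar)) ⊆
      ⋃ q, pc q '' ((Subtype.val : ↥(negCone (Jstar.map τ)) → Fin 2 → ℂ) ⁻¹' F q) := by
    intro P _
    obtain ⟨v, hv, u, rfl⟩ := ShimuraSetGS.mk_surjective L Jstar τ Kstar P
    set q : Q := Quotient.mk'' (CosetSpace.pt (rationalToFinAdelic (↥(maximalRealSubfield L)) L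
      (IsCMField.complexConj L) 2 Jstar) Kstar u) with hq
    -- `pt (g q)` and `pt u` are in one `U(J⋆)(L⁺)`-orbit: `(γ_f u)⁻¹ g_q ∈ K⋆`
    have horb := Quotient.exact' ((hg q).trans hq)
    obtain ⟨γ, hγ⟩ := MulAction.orbitRel_apply.1 horb
    dsimp only at hγ
    rw [CosetSpace.smul_pt, CosetSpace.pt_eq_pt_iff] at hγ
    set γf : ↥(finAdelic (↥(maximalRealSubfield L)) L (IsCMField.complexConj L) 2 Jstar) :=
      rationalToFinAdelic (↥(maximalRealSubfield L)) L (IsCMField.complexConj L) 2 Jstar γ with hγf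
    -- `[v, uK⋆] = [γ^τ v, γ_f u K⋆] = [γ^τ v, g_q K⋆]`
    have hγv : ((ratToGLℂ L Jstar τ γ : GL (Fin 2) ℂ) : Matrix (Fin 2) (Fin 2) ℂ) *ᵥ v ∈ negCone (Jstar.map τ) := by
      have h := smul_ratToGLℂ_mulVec_mem_negCone L Jstar τ γ one_ne_zero hv
      rwa [one_smul] at h
    have h1 : ShimuraSetGS.mk L Jstar τ Kstar v hv u = ShimuraSetGS.mk L Jstar τ Kstar _ hγv (g q) := by
      have h2 : ShimuraSetGS.mk L Jstar τ Kstar _ hγv (γf * u) = ShimuraSetGS.mk L Jstar τ Kstar v hv u := by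
        have h3 := ShimuraSetGS.mk_smul_mulVec L Jstar τ Kstar γ one_ne_zero v hv
          (by rw [one_smul]; exact hγv) u
        simpa only [one_smul] using h3
      rw [← h2]
      -- `γ_f u = g_q · k⁻¹` with `k := (γ_f u)⁻¹ g_q ∈ K⋆`
      have h4 : γf * u = g q * ((γf * u)⁻¹ * g q)⁻¹ := by group
      rw [h4]
      exact ShimuraSetGS.mk_mul_of_mem L Jstar τ Kstar _ hγv (g q) (Kstar.inv_mem hγ)
    -- move the disc vector into the fundamental set of `Γ(g_q K⋆ g_q⁻¹)`
    obtain ⟨δ, hδK, c, hc, hcF⟩ := hFfund q _ hγv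
    set δf : ↥(finAdelic (↥(maximalRealSubfield L)) L (IsCMField.complexConj L) 2 Jstar) :=
      rationalToFinAdelic (↥(maximalRealSubfield L)) L (IsCMField.complexConj L) 2 Jstar δ with hδf
    -- `δ^τ` is `ratToGLℂ δ` (definitionally)
    change c • (((ratToGLℂ L Jstar τ δ : GL (Fin 2) ℂ) : Matrix (Fin 2) (Fin 2) ℂ) *ᵥ
      (((ratToGLℂ L Jstar τ γ : GL (Fin 2) ℂ) : Matrix (Fin 2) (Fin 2) ℂ) *ᵥ v)) ∈ F q at hcF
    have hw : c • (((ratToGLℂ L Jstar τ δ : GL (Fin 2) ℂ) : Matrix (Fin 2) (Fin 2) ℂ) *ᵥ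
        (((ratToGLℂ L Jstar τ γ : GL (Fin 2) ℂ) : Matrix (Fin 2) (Fin 2) ℂ) *ᵥ v)) ∈ negCone (Jstar.map τ) := hFsub q hcF
    have h7 : (g q)⁻¹ * (δf⁻¹ * g q) ∈ Kstar := by
      convert Kstar.inv_mem hδK using 1
      rw [hδf]
      group
    have h5 : ShimuraSetGS.mk L Jstar τ Kstar _ hγv (g q) = ShimuraSetGS.mk L Jstar τ Kstar _ hw (g q) := by
      have h6 := ShimuraSetGS.mk_smul_mulVec L Jstar τ Kstar δ hc _ hγv hw (δf⁻¹ * g q)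
      rw [← hδf, mul_inv_cancel_left] at h6
      rw [h6]
      exact (ShimuraSetGS.mk_mul_eq_mk_of_conj_mem L Jstar τ Kstar _ hγv (g q) δf⁻¹ h7).symm
    rw [h1, h5]
    exact Set.mem_iUnion.2 ⟨q, ⟨⟨_, hw⟩, hcF, rfl⟩⟩
  exact (isCompact_iUnion fun q => (hFc' q).image (hpc q)).of_isClosed_subset isClosed_univ hcover

end Compact

/-! ### §3 Through the frame: anisotropy of `H` suffices -/

section Frame

variable (L) (H : Matrix (Fin 3) (Fin 3) L) (τ : L →+* ℂ)
  (Jstar : Matrix (Fin 2) (Fin 2) L) (Jperp : Matrix (Fin 1) (Fin 1) L) (B : GL (Fin 3) L) {a : L} (ha : a ≠ 0)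
  (hB : formCongr ((IsCMField.complexConj L : L ≃ₐ[↥(maximalRealSubfield L)] L) : L →+* L) B (a • H) =
    finSum 2 1 Jstar Jperp)

include ha hB in
/-- **Compactness of the curve's Shimura set from the anisotropy of `H`** (through the frame, ★ `anisotropic_of_frame`): the form used by
the road-(ii) assembly, whose hypotheses are stated on the surface datum. [cite: PlatonovRapinchuk1994, §5.1 Thm. 5.1 and §4.6]
[cite: Milne2005ShimuraVarieties, Thm. 5.16] -/
theorem ShimuraSetGS.compactSpace_of_frame
    (hanis : ∀ v : Fin 3 → L, hermForm (cmConjRingHom L) H v v = 0 → v = 0)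
    {Tstar : GL (Fin 2) ℂ} (hTstar : formCongr (starRingEnd ℂ) Tstar (Jstar.map τ) = Matrix.diagonal ![(1 : ℂ), -1])
    (Kstar : Subgroup ↥(finAdelic (↥(maximalRealSubfield L)) L (IsCMField.complexConj L) 2 Jstar))
    (hKo : IsOpen (Kstar : Set ↥(finAdelic (↥(maximalRealSubfield L)) L (IsCMField.complexConj L) 2 Jstar))) :
    CompactSpace (ShimuraSetGS L Jstar τ Kstar) :=
  ShimuraSetGS.compactSpace_of_anisotropic L Jstar τ (anisotropic_of_frame L H Jstar Jperp B ha hB hanis) hTstar Kstar hKo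

end Frame

end Literature.AlgebraicGeometry.ShimuraVarieties.UnitaryCanonicalModel

end
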